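import Mathlib
import Literature.Analysis.SpecialFunctions.GaussLegendreQuadrature
import Literature.Analysis.Quadrature.ChebyshevCoefficients

/-!
# The aliasing bound for Gauss–Legendre quadrature (Trefethen 2008, proof of Thms. 4.5/5.1)

**Lemma** (the mechanism of [cite: Trefethen2008, Thm. 4.5], eqs. (4.2), (5.2)–(5.3) and the
last paragraph of the proof of Thm. 5.1, isolated as a statement about Chebyshev coefficients;
`norm_integral_sub_gaussLegendre_le_of_chebCoeff_le`): *let `f ∈ C[-1, 1]` (complex-valued) have
Chebyshev coefficients `|a_j(f)| ≤ b_j` (`a_j` as in `ChebyshevCoefficients`, (4.4) loc. cit.)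
with `Σ_j b_j < ∞`.  Then for the `n`-point Gauss–Legendre rule with `n ≥ 2`,*
`|∫_{-1}^{1} f(x) dx - Σ_x w_x f(x)| ≤ (32/15) Σ_{j ≥ 2n} b_j`.

Ingredients, as loc. cit.: `f = Σ' a_j T_j` on `[-1, 1]`, absolutely and uniformly convergent
(realised here as the Fourier series of the even `2π`-periodic function `f(cos θ)`, whose `k`-th
Fourier coefficient is `a_{|k|} / 2`, and integrated termwise against the error functional by
dominated convergence); the rule is exact on `T_j` for `j ≤ 2n - 1` (`glErrT_eq_zero`); and for the
aliased `T_j`, `j ≥ 2n ≥ 4`, `|∫_{-1}^{1} T_j - Σ_x w_x T_j(x)| ≤ 2/(j² - 1) + 2 ≤ 2/15 + 2 = 32/15`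
(`abs_glErrT_le`; "since `j ≥ 4` … `32/15`", p. 78 loc. cit.).  Throughout, `n` is the NUMBER OF
NODES (`gaussLegendreNodes n`); Trefethen writes the same rule with `n + 1` nodes.

Used by `GaussLegendreBoundedVariation` (Thm. 4.5 (4.13)).  The geometric special case
`b_j = 2M ρ^{-j}` with the constant `4` (valid for `n ≥ 1`) in place of `32/15` is
`Literature.Analysis.Quadrature.norm_integral_sub_gaussLegendre_le` (`GaussLegendreAnalytic`,
Thm. 4.5 (4.14)); that file is independent of this one.

## References

* L. N. Trefethen, *Is Gauss quadrature better than Clenshaw–Curtis?*, SIAM Review **50** (2008)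
  67–87, Thm. 4.5 and the proof of Thm. 5.1. [cite: Trefethen2008, Thm. 4.5]

AI-produced formalisation (H21 engines group, seat eng-quad-3, 2026-08-20); no facts, no axioms
beyond Mathlib's, no `sorry`.
-/

open Set MeasureTheory Filter Topology

open scoped Real Interval

namespace Literature.Analysis.Quadrature

open Literature.Analysis.SpecialFunctions Polynomial.Chebyshev

/-! ### The Gauss–Legendre error on Chebyshev polynomials -/

/-- The `n`-point Gauss–Legendre quadrature error `I(T_k) - I_n(T_k)` on the Chebyshev polynomial
`T_k` (`k ∈ ℤ`, `T_{-k} = T_k`; Trefethen 2008 (4.2) applied to `T_k`).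
[cite: Trefethen2008, Thm. 4.5] -/
noncomputable def glErrT (n : ℕ) (k : ℤ) : ℝ :=
  (∫ t in (-1 : ℝ)..1, (T ℝ k).eval t) -
    ∑ x ∈ gaussLegendreNodes n, gaussLegendreWeight n x * (T ℝ k).eval x

/-- Gauss–Legendre with `n` nodes is exact on `T_k` for `|k| ≤ 2n - 1`. [folklore] -/
private theorem glErrT_eq_zero {n : ℕ} {k : ℤ} (hk : k.natAbs < 2 * n) : glErrT n k = 0 := by
  rw [glErrT, sub_eq_zero]
  exact integral_eq_sum_gaussLegendreWeight_mul (by rwa [Polynomial.Chebyshev.natDegree_T])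

/-- `|Σ_x w_x T_k(x)| ≤ Σ_x w_x = 2` (`n ≥ 1`). [folklore] -/
private theorem abs_sum_gaussLegendreWeight_mul_T_le {n : ℕ} (hn : 1 ≤ n) (k : ℤ) :
    |∑ x ∈ gaussLegendreNodes n, gaussLegendreWeight n x * (T ℝ k).eval x| ≤ 2 := by
  calc |∑ x ∈ gaussLegendreNodes n, gaussLegendreWeight n x * (T ℝ k).eval x|
      ≤ ∑ x ∈ gaussLegendreNodes n, |gaussLegendreWeight n x * (T ℝ k).eval x| :=
        Finset.abs_sum_le_sum_abs _ _
    _ ≤ ∑ x ∈ gaussLegendreNodes n, gaussLegendreWeight n x := by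
        refine Finset.sum_le_sum fun x hx => ?_
        have hw := gaussLegendreWeight_pos hx
        have hx' := mem_Ioo_of_mem_gaussLegendreNodes hx
        have hT := abs_eval_T_real_le_one k (x := x) (abs_le.mpr ⟨hx'.1.le, hx'.2.le⟩)
        rw [abs_mul, abs_of_pos hw]
        nlinarith
    _ = 2 := sum_gaussLegendreWeight hn

/-- For `n ≥ 2` and `|k| ≥ 2n` (so `|k| ≥ 4`):
`|E_n(T_k)| ≤ |∫_{-1}^{1} T_k| + Σ_x w_x |T_k(x)| ≤ 2/(k² - 1) + 2 ≤ 2/15 + 2 = 32/15`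
(Trefethen 2008, end of the proof of Thm. 5.1). [cite: Trefethen2008, Thm. 4.5 (4.13)] -/
theorem abs_glErrT_le {n : ℕ} (hn : 2 ≤ n) {k : ℤ} (hk : 2 * n ≤ k.natAbs) :
    |glErrT n k| ≤ 32 / 15 := by
  have h4 : 4 ≤ k.natAbs := by omega
  have h1 : |∫ t in (-1 : ℝ)..1, (T ℝ k).eval t| ≤ 2 / 15 := by
    rw [← T_natAbs ℝ k]
    refine (abs_integral_T_le (j := k.natAbs) (by omega)).trans ?_
    have h4' : (4 : ℝ) ≤ k.natAbs := by exact_mod_cast h4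
    rw [div_le_div_iff₀ (by nlinarith) (by norm_num)]
    nlinarith
  have h2 := abs_sum_gaussLegendreWeight_mul_T_le (by omega : 1 ≤ n) k
  rw [glErrT]
  exact (abs_sub _ _).trans (by linarith)

/-! ### The aliasing lemma -/

/-- **Aliasing bound for Gauss–Legendre quadrature** (the mechanism of Trefethen 2008, Thms. 4.5
and 5.1, isolated): let `f` be continuous on `[-1, 1]` with Chebyshev coefficients
`|a_j(f)| ≤ b_j` for a summable majorant `b`.  Then `f = Σ' a_j T_j` on `[-1, 1]` (absolutely
convergent), the `n`-point rule (`n ≥ 2`) is exact on `T_j` for `j < 2n`, and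
`|∫ T_j - Σ_x w_x T_j(x)| ≤ 32/15` for `j ≥ 2n ≥ 4`, whence
`‖∫_{-1}^{1} f - Σ_x w_x f(x)‖ ≤ (32/15) Σ_{j ≥ 2n} b_j`.
(The Chebyshev series is realised as the Fourier series of the even `2π`-periodic function
`f (cos θ)`, whose `k`-th Fourier coefficient is `a_{|k|}/2`; it is integrated termwise against the
quadrature error functional by dominated convergence.) [cite: Trefethen2008, Thm. 4.5 (4.13)] -/
theorem norm_integral_sub_gaussLegendre_le_of_chebCoeff_le {f : ℝ → ℂ}
    (hf : ContinuousOn f (Icc (-1 : ℝ) 1)) {b : ℕ → ℝ} (hb : ∀ j, ‖chebCoeff f j‖ ≤ b j)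
    (hbs : Summable b) {n : ℕ} (hn : 2 ≤ n) :
    ‖(∫ t in (-1 : ℝ)..1, f t) -
        ∑ x ∈ gaussLegendreNodes n, (gaussLegendreWeight n x : ℂ) * f x‖ ≤
      32 / 15 * ∑' i : ℕ, b (i + 2 * n) := by
  have hb0 : ∀ j, 0 ≤ b j := fun j => (norm_nonneg _).trans (hb j)
  -- ### Step 1: `g = f ∘ cos` on the circle `ℝ/2πℤ`
  have h2π : (0 : ℝ) < 2 * π := Real.two_pi_pos
  haveI : Fact ((0 : ℝ) < 2 * π) := ⟨h2π⟩
  set g : ℝ → ℂ := fun θ => f (Real.cos θ) with hg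
  have hgc : Continuous g := hf.comp_continuous Real.continuous_cos Real.cos_mem_Icc
  let F : C(AddCircle (2 * π), ℂ) :=
    ⟨AddCircle.liftIco (2 * π) 0 g, AddCircle.liftIco_continuous (by simp [hg]) hgc.continuousOn⟩
  have hFapply : ∀ x : ℝ, x ∈ Ico 0 (2 * π) → F (x : AddCircle (2 * π)) = g x := by
    intro x hx
    show AddCircle.liftIco (2 * π) 0 g x = g x
    exact AddCircle.liftIco_coe_apply (by rwa [zero_add])
  -- ### Step 2: the Fourier coefficients of `F` are `a_{|k|}(f) / 2`
  set c : ℤ → ℂ := fun k => fourierCoeff F k with hc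
  have hcoeff : ∀ k : ℤ, c k = chebCoeff f k.natAbs / 2 := by
    intro k
    set h : ℝ → ℂ := fun x => Complex.exp (-(k * x * Complex.I)) * g x with hh
    have hhc : Continuous h :=
      (by fun_prop : Continuous fun x : ℝ => Complex.exp (-(k * x * Complex.I))).mul hgc
    have h1 : c k = (1 / (2 * π) : ℝ) • ∫ x in (0 : ℝ)..2 * π, h x := by
      simp only [hc]
      rw [fourierCoeff_eq_intervalIntegral F k 0, zero_add]
      congr 1
      refine intervalIntegral.integral_congr_Ioo_of_le h2π.le fun x hx => ?_
      rw [fourier_coe_apply, hFapply x (Ioo_subset_Ico_self hx), smul_eq_mul]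
      simp only [hh]
      congr 2
      rw [div_eq_iff (by exact_mod_cast h2π.ne' : ((2 * π : ℝ) : ℂ) ≠ 0)]
      push_cast
      ring
    -- split at `π` and fold `[π, 2π]` back onto `[0, π]` by `x ↦ 2π - x`
    have hsplit : ∫ x in (0 : ℝ)..2 * π, h x =
        (∫ x in (0 : ℝ)..π, h x) + ∫ x in π..2 * π, h x :=
      (intervalIntegral.integral_add_adjacent_intervals (hhc.intervalIntegrable _ _)
        (hhc.intervalIntegrable _ _)).symm
    have hrefl : ∫ x in π..2 * π, h x = ∫ x in (0 : ℝ)..π, h (2 * π - x) := by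
      have e := intervalIntegral.integral_comp_sub_left h (2 * π) (a := 0) (b := π)
      rw [sub_zero, show 2 * π - π = π by ring] at e
      exact e.symm
    have hper : ∀ x : ℝ, h (2 * π - x) = Complex.exp (k * x * Complex.I) * g x := by
      intro x
      simp only [hh, hg, Real.cos_two_pi_sub]
      congr 1
      rw [show -((k : ℂ) * ((2 * π - x : ℝ) : ℂ) * Complex.I) =
          k * x * Complex.I + ((-k : ℤ) : ℂ) * (2 * π * Complex.I) by push_cast; ring,
        Complex.exp_add, Complex.exp_eq_one_iff.mpr ⟨-k, rfl⟩, mul_one]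
    have hcosabs : ∀ x : ℝ, Real.cos (((k.natAbs : ℕ) : ℝ) * x) = Real.cos ((k : ℝ) * x) := by
      intro x
      have e : ((k.natAbs : ℕ) : ℝ) = |(k : ℝ)| := by
        rw [← Int.cast_natCast, Int.natCast_natAbs, Int.cast_abs]
      rw [e]
      rcases abs_choice (k : ℝ) with h | h <;> rw [h]
      rw [neg_mul, Real.cos_neg]
    have hsum : (∫ x in (0 : ℝ)..π, h x) + (∫ x in (0 : ℝ)..π, h (2 * π - x)) =
        2 * ∫ x in (0 : ℝ)..π, g x * (Real.cos (((k.natAbs : ℕ) : ℝ) * x) : ℂ) := by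
      rw [← intervalIntegral.integral_const_mul,
        ← intervalIntegral.integral_add (hhc.intervalIntegrable _ _)
          ((by fun_prop : Continuous fun x : ℝ => h (2 * π - x)).intervalIntegrable _ _)]
      refine intervalIntegral.integral_congr fun x _ => ?_
      rw [hper x]
      simp only [hh]
      rw [hcosabs]
      push_cast
      have e2 := Complex.two_cos ((k : ℂ) * x)
      rw [neg_mul] at e2
      linear_combination -(g x) * e2
    rw [h1, hsplit, hrefl, hsum, chebCoeff]
    simp only [hg]
    rw [Complex.real_smul]
    push_cast
    ring
  -- ### Step 3: summability of the coefficients; the pointwise Chebyshev series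
  have hnorm : ∀ k : ℤ, ‖c k‖ ≤ b k.natAbs / 2 := by
    intro k
    rw [hcoeff, norm_div, Complex.norm_two]
    exact div_le_div_of_nonneg_right (hb _) zero_le_two
  have hbZ : Summable fun k : ℤ => b k.natAbs / 2 := by
    refine Summable.of_nat_of_neg_add_one ?_ ?_
    · simpa using hbs.div_const 2
    · have e : ∀ j : ℕ, (-((j : ℤ) + 1)).natAbs = j + 1 := fun j => by omega
      simp only [e]
      exact ((summable_nat_add_iff 1).mpr hbs).div_const 2
  have hsumF : Summable (fourierCoeff F) := Summable.of_norm_bounded hbZ hnorm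
  have hsumC : Summable fun k : ℤ => ‖c k‖ :=
    Summable.of_nonneg_of_le (fun _ => norm_nonneg _) hnorm hbZ
  have hceven : ∀ k : ℤ, c (-k) = c k := fun k => by rw [hcoeff, hcoeff, Int.natAbs_neg]
  have hpt : ∀ θ : ℝ, θ ∈ Icc 0 π →
      HasSum (fun k : ℤ => c k * Complex.exp (k * θ * Complex.I)) (g θ) := by
    intro θ hθ
    have hx : θ ∈ Ico 0 (2 * π) := ⟨hθ.1, by linarith [hθ.2, Real.pi_pos]⟩
    have h := has_pointwise_sum_fourier_series_of_summable hsumF θ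
    rw [hFapply _ hx] at h
    convert h using 2 with k
    rw [fourier_coe_apply, smul_eq_mul]
    congr 2
    push_cast
    field_simp
  have hsym : ∀ θ : ℝ, θ ∈ Icc 0 π →
      HasSum (fun k : ℤ => c k * Complex.cos (k * θ)) (g θ) := by
    intro θ hθ
    have h1 := hpt θ hθ
    have h2 : HasSum (fun k : ℤ => c k * Complex.exp (-(k * θ) * Complex.I)) (g θ) := by
      have h := (Equiv.neg ℤ).hasSum_iff.mpr h1
      convert h using 2 with k
      simp only [Function.comp_apply, Equiv.neg_apply, hceven]
      push_cast
      ring_nf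
    have h3 := (h1.add h2).div_const 2
    rw [← two_mul, mul_div_cancel_left₀ _ two_ne_zero] at h3
    have e : ∀ k : ℤ, (c k * Complex.exp (k * θ * Complex.I) +
        c k * Complex.exp (-(k * θ) * Complex.I)) / 2 = c k * Complex.cos (k * θ) := fun k => by
      rw [← mul_add, ← Complex.two_cos]
      ring
    simp only [e] at h3
    exact h3
  have hcheb : ∀ t : ℝ, t ∈ Icc (-1 : ℝ) 1 →
      HasSum (fun k : ℤ => c k * (((T ℝ k).eval t : ℝ) : ℂ)) (f t) := by
    intro t ht
    have hθ : Real.arccos t ∈ Icc 0 π := ⟨Real.arccos_nonneg t, Real.arccos_le_pi t⟩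
    have h := hsym (Real.arccos t) hθ
    have hgt : g (Real.arccos t) = f t := by
      simp only [hg]
      rw [Real.cos_arccos ht.1 ht.2]
    rw [hgt] at h
    convert h using 2 with k
    congr 1
    conv_lhs => rw [← Real.cos_arccos ht.1 ht.2]
    rw [Polynomial.Chebyshev.T_real_cos, Complex.ofReal_cos]
    push_cast
    ring_nf
  -- ### Step 4: integrate termwise (dominated convergence) and evaluate termwise at the nodes
  have hInt : HasSum (fun k : ℤ => c k * (((∫ t in (-1 : ℝ)..1, (T ℝ k).eval t : ℝ) : ℂ)))
      (∫ t in (-1 : ℝ)..1, f t) := by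
    have h := intervalIntegral.hasSum_integral_of_dominated_convergence
      (F := fun (k : ℤ) (t : ℝ) => c k * (((T ℝ k).eval t : ℝ) : ℂ)) (f := f)
      (μ := volume) (a := (-1 : ℝ)) (b := 1) (fun k _ => ‖c k‖) (fun k => ?_) (fun k => ?_)
      ?_ ?_ ?_
    · have e : ∀ k : ℤ, (∫ t in (-1 : ℝ)..1, c k * (((T ℝ k).eval t : ℝ) : ℂ)) =
          c k * (((∫ t in (-1 : ℝ)..1, (T ℝ k).eval t : ℝ) : ℂ)) := fun k => by
        rw [intervalIntegral.integral_const_mul, intervalIntegral.integral_ofReal]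
      simp only [e] at h
      exact h
    · exact (continuous_const.mul
        (Complex.continuous_ofReal.comp (Polynomial.continuous _))).aestronglyMeasurable
    · exact ae_of_all _ fun t ht => by
        rw [norm_mul, Complex.norm_real, Real.norm_eq_abs]
        refine mul_le_of_le_one_right (norm_nonneg _) (abs_eval_T_real_le_one k ?_)
        rw [Set.uIoc_of_le (by norm_num)] at ht
        exact abs_le.mpr ⟨ht.1.le, ht.2⟩
    · exact ae_of_all _ fun t _ => hsumC
    · exact intervalIntegrable_const
    · exact ae_of_all _ fun t ht => by
        rw [Set.uIoc_of_le (by norm_num)] at ht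
        exact hcheb t ⟨ht.1.le, ht.2⟩
  have hNode : HasSum (fun k : ℤ => c k *
      (((∑ x ∈ gaussLegendreNodes n, gaussLegendreWeight n x * (T ℝ k).eval x : ℝ) : ℂ)))
      (∑ x ∈ gaussLegendreNodes n, (gaussLegendreWeight n x : ℂ) * f x) := by
    have h := hasSum_sum fun x (hx : x ∈ gaussLegendreNodes n) =>
      (hcheb x (Ioo_subset_Icc_self (mem_Ioo_of_mem_gaussLegendreNodes hx))).mul_left
        (gaussLegendreWeight n x : ℂ)
    have e : ∀ k : ℤ, ∑ x ∈ gaussLegendreNodes n,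
        (gaussLegendreWeight n x : ℂ) * (c k * (((T ℝ k).eval x : ℝ) : ℂ)) =
          c k * (((∑ x ∈ gaussLegendreNodes n,
            gaussLegendreWeight n x * (T ℝ k).eval x : ℝ) : ℂ)) := fun k => by
      push_cast
      rw [Finset.mul_sum]
      exact Finset.sum_congr rfl fun x _ => by ring
    simp only [e] at h
    exact h
  have hErr : HasSum (fun k : ℤ => c k * (glErrT n k : ℂ))
      ((∫ t in (-1 : ℝ)..1, f t) -
        ∑ x ∈ gaussLegendreNodes n, (gaussLegendreWeight n x : ℂ) * f x) := by
    have h := hInt.sub hNode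
    have e : ∀ k : ℤ, c k * (((∫ t in (-1 : ℝ)..1, (T ℝ k).eval t : ℝ) : ℂ)) -
        c k * (((∑ x ∈ gaussLegendreNodes n, gaussLegendreWeight n x * (T ℝ k).eval x : ℝ) : ℂ)) =
          c k * (glErrT n k : ℂ) := fun k => by
      rw [glErrT]
      push_cast
      ring
    simp only [e] at h
    exact h
  -- ### Step 5: the terms `|k| < 2n` vanish, the others are `≤ (16/15) b_{|k|}`; sum the majorant
  set s : ℤ → ℂ := fun k => c k * (glErrT n k : ℂ) with hs
  set m : ℤ → ℝ := fun k => if 2 * n ≤ k.natAbs then 16 / 15 * b k.natAbs else 0 with hm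
  have hsm : ∀ k : ℤ, ‖s k‖ ≤ m k := by
    intro k
    simp only [hs, hm]
    split_ifs with hk
    · rw [norm_mul, Complex.norm_real, Real.norm_eq_abs]
      calc ‖c k‖ * |glErrT n k| ≤ b k.natAbs / 2 * (32 / 15) :=
            mul_le_mul (hnorm k) (abs_glErrT_le hn hk) (abs_nonneg _)
              (by linarith [hb0 k.natAbs])
        _ = 16 / 15 * b k.natAbs := by ring
    · rw [glErrT_eq_zero (by omega), Complex.ofReal_zero, mul_zero, norm_zero]
  set a : ℝ := 16 / 15 * ∑' i : ℕ, b (i + 2 * n) with ha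
  have hbtail : HasSum (fun i : ℕ => 16 / 15 * b (i + 2 * n)) a :=
    ((summable_nat_add_iff (2 * n)).mpr hbs).hasSum.mul_left (16 / 15)
  set mN : ℕ → ℝ := fun j => if 2 * n ≤ j then 16 / 15 * b j else 0 with hmN
  have hmNsum : HasSum mN a := by
    rw [← hasSum_nat_add_iff' (2 * n)]
    have h0 : ∑ i ∈ Finset.range (2 * n), mN i = 0 :=
      Finset.sum_eq_zero fun i hi => by
        simp only [hmN]
        rw [if_neg (by simpa using hi)]
    rw [h0, sub_zero]
    have e : (fun i : ℕ => mN (i + 2 * n)) = fun i => 16 / 15 * b (i + 2 * n) := by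
      funext i
      simp only [hmN]
      rw [if_pos (by omega)]
    rw [e]
    exact hbtail
  have hmpos : HasSum (fun j : ℕ => m (j : ℤ)) a := by
    have e : (fun j : ℕ => m (j : ℤ)) = mN := by
      funext j
      simp only [hm, hmN, Int.natAbs_natCast]
    rw [e]
    exact hmNsum
  have hmneg : HasSum (fun j : ℕ => m (-((j : ℤ) + 1))) a := by
    have e : (fun j : ℕ => m (-((j : ℤ) + 1))) = fun j => mN (j + 1) := by
      funext j
      have : (-((j : ℤ) + 1)).natAbs = j + 1 := by omega
      simp only [hm, hmN, this]
    have h0 : ∑ i ∈ Finset.range 1, mN i = 0 := by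
      rw [Finset.sum_range_one]
      simp only [hmN]
      rw [if_neg (by omega)]
    have h := (hasSum_nat_add_iff' (f := mN) 1).mpr hmNsum
    rw [h0, sub_zero] at h
    rw [e]
    exact h
  have hmsum : HasSum m (a + a) := HasSum.of_nat_of_neg_add_one hmpos hmneg
  have hfin : a + a = 32 / 15 * ∑' i : ℕ, b (i + 2 * n) := by
    rw [ha]
    ring
  rw [← hErr.tsum_eq, ← hfin]
  exact tsum_of_norm_bounded hmsum hsm

end Literature.Analysis.Quadrature
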